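import Mathlib.CategoryTheory.Limits.IsLimit
import Mathlib.CategoryTheory.Filtered.Basic
import Mathlib.CategoryTheory.ObjectProperty.FullSubcategory
import Literature.AlgebraicGeometry.Frobenioids.DivisorMonoidCategoryTheoreticity
import Literature.AlgebraicGeometry.Frobenioids.CategoriesFactorization
import Literature.AlgebraicGeometry.Frobenioids.EquivalenceUnitsTransport
import Literature.AlgebraicGeometry.Frobenioids.Frobenioid
import Literature.AnabelianGeometry.EtaleTheta.TemperedFrobenioidProps
import HarnessLib

/-!
# [EtTh] Corollary 3.8 (i), (ii) — the printed PROOF as a sub-DAG of intermediate STATEMENTS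

Mochizuki, *The étale theta function …*, Publ. RIMS **45** (2009), Cor. 3.8 "Preservation of Base-field-theoretic
Morphisms and Hulls", PDF pp. 80–81 (printed 306–307), PROOF PDF pp. 81–82 [cite: MochizukiEtTh2009, Cor 3.8 p.81].
abc-iut cell, layer L2, D-0068 (1) statements-first sub-DAG (nodes `EtTh:Cor3.8(i)`, `EtTh:Cor3.8(ii)`; seat
abc-iut-w5-d124; table `plan/L2/SUBDAG-EtTh-Cor38.md`). The typed STATEMENTS are abc-iut-L2-t3's `Cor38_i` /
`Cor38_ii` over `Cor38Hyp` (`TemperedFrobenioidProps.lean`, not re-typed); (iii) is abc-iut-L2-d2's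
`Discharge/Sec3Cor38iii.lean` and is not part of this file. Here: one declaration per sentence of the printed
proof of (i)/(ii) — rows C38-L01 … C38-L10 — over the BUILT vocabulary (L2-t3's tempered Frobenioids: `category`,
`toElem`, `IsBaseFieldTheoretic`, `hull`, `Remark363`; L1's [FrdI] operations language `PreFrobenioidData`:
pre-steps, primary steps, `O^▷(−) = endSubmonoid`, `PerfectionData`, `OneUniqueSquare`, `Thm34ii/iii/iv`,
`Thm42Setting/Thm42i`, `Cor411ii`, `IsFrobeniusSlim`, `IsDivSlim`, `IsAbstractlyEquivalent`), with the derivation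
rows that are pure logic PROVED and the genuine transport rows (L06 ⟸ L02–L05, L09, L10 ⟸ Rmk 3.6.3) typed as
named `Prop` implications for provers. Nothing is asserted; no statement of the paper is strengthened.
HONEST FRAMING: refereed pre-IUT material; nothing here bears on [IUTchIII] Cor. 3.12; typed ≠ proved.
-/


namespace Literature.AnabelianGeometry.EtaleTheta

open CategoryTheory Opposite Literature.AlgebraicGeometry.Frobenioids

universe u₀ v₀ u v w

variable {D₀ : Type u₀} [Category.{v₀} D₀] {V : FrdIMonoidStub.{w}}
  {T : RealifiedDivisorMonoids (D₀ := D₀) V} {D : Type u} [Category.{v} D] {VD : FrdICatStub.{u, v, w} D}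

namespace TemperedFrobenioid

variable (C : TemperedFrobenioid T D VD)

/-- The [FrdI] OPERATIONS `(Base, Div, deg_Fr)` of the Frobenioid `C` of a tempered Frobenioid, in L1's
packaging `PreFrobenioidData.ofFunctor` of `C.toElem` (= `ModelFrobenioid.data`; Def. 3.6 (ii) p.77) — the language
of the [FrdI] theorems the proof of Cor. 3.8 quotes. (bookkeeping) [cite: MochizukiEtTh2009, Def 3.6 p.77] -/
noncomputable abbrev opsData : PreFrobenioidData.{w} C.category D :=
  PreFrobenioidData.ofFunctor C.divisorMonoid C.toElem

end TemperedFrobenioid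

namespace TemperedFrobenioid

variable {C : TemperedFrobenioid T D VD} (P : PerfectionData C.opsData)

/-- "pre-steps `A' → B` [of `C^pf`] that are abstractly equivalent [cf. §0] to an endomorphism that belongs
to '`O^▷(−)`'" (p.81): a co-angular pre-step of `C^pf` abstractly equivalent ([FrdI] §0) to an element of some
`O^▷(A'') = endSubmonoid A''` of `C^pf`. [cite: MochizukiEtTh2009, Cor 3.8 p.81] -/
def IsOTriLikePreStep {X Y : P.Pf} (ψ : X ⟶ Y) : Prop :=
  P.ops.IsCoAngularPreStep ψ ∧
    ∃ (A'' : P.Pf) (ε : A'' ⟶ A''), (ε : End A'') ∈ P.ops.endSubmonoid A'' ∧ IsAbstractlyEquivalent ψ ε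

/-- The category "`(C^pf)^coa-pre_B` [where 'coa-pre' denotes the subcategory determined by the
(necessarily co-angular) pre-steps of `C^pf`]" (p.81): the full subcategory of `Over B` on the co-angular
pre-steps `X → B` of `C^pf`. [cite: MochizukiEtTh2009, Cor 3.8 p.81] -/
abbrev CoaPreOver (B : P.Pf) : Type _ :=
  ObjectProperty.FullSubcategory fun X : Over B => P.ops.IsCoAngularPreStep X.hom

/-- "… may be written as a [filtered] projective limit in the category `(C^pf)^coa-pre_B` … of pre-steps
`A' → B` that are abstractly equivalent to an endomorphism that belongs to '`O^▷(−)`'" (p.81), for a co-angular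
pre-step `ψ : X → B` of `C^pf`: `ψ` is a cofiltered limit of such in `(C^pf)^coa-pre_B`. [cite: MochizukiEtTh2009, Cor 3.8 p.81] -/
def IsLimitOfOTriLike {X B : P.Pf} (ψ : X ⟶ B) : Prop :=
  ∃ (hψ : P.ops.IsCoAngularPreStep ψ) (J : Type (max v w)) (_ : SmallCategory J) (_ : IsCofiltered J)
    (F : J ⥤ CoaPreOver P B) (π : (Functor.const J).obj (⟨Over.mk ψ, hψ⟩ : CoaPreOver P B) ⟶ F),
    (∀ j, IsOTriLikePreStep P (F.obj j).obj.hom) ∧ Nonempty (Limits.IsLimit (Limits.Cone.mk _ π))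

variable (C) in
/-- **C38-L05** (proof of Cor. 3.8, p.81, "Now observe … that a pre-step of `C_i` is base-field-theoretic
if and only if its image `A → B` in `C_i^pf` may be written as a [filtered] projective limit in
`(C_i^pf)^coa-pre_B` of pre-steps `A' → B` that are abstractly equivalent to an endomorphism that belongs to
'`O^▷(−)`'" — justified in print by Prop. 3.4 (ii) and [FrdI] Def. 1.3 (iii)(d)): the INTRINSIC characterisation
of base-field-theoretic pre-steps, over a perfection `P` of the operations of `C` ([FrdI] Prop. 3.2 (i) interface
`PerfectionData`; dischargeable for a CONSTRUCTED `P` only). Named `Prop`. [cite: MochizukiEtTh2009, Cor 3.8 p.81] -/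
def BsFldPreStepLimitCriterion (P : PerfectionData C.opsData) : Prop :=
  ∀ ⦃A B : C.category⦄ (φ : A ⟶ B), C.opsData.IsPreStep φ →
    (C.IsBaseFieldTheoretic φ ↔ IsLimitOfOTriLike P (P.toPf.map φ))

end TemperedFrobenioid

/-! ## The rows over the data of Cor. 3.8: `Ψ : C₁ ⥲ C₂`, `D_i` of FSMFF-type, `Φ_i` non-dilating -/
section Rows

variable {D₀' : Type u₀} [Category.{v₀} D₀'] {T' : RealifiedDivisorMonoids (D₀ := D₀') V}
  {D' : Type u} [Category.{v} D'] {VD' : FrdICatStub.{u, v, w} D'}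
  {C₁ : TemperedFrobenioid T D VD} {C₂ : TemperedFrobenioid T' D' VD'}

namespace Cor38Hyp

variable (h : Cor38Hyp C₁ C₂)

/-- **C38-L01** (proof of Cor. 3.8, p.81 l.1–2: "by Theorem 3.7, (i), (ii), `C₁`, `C₂` are of standard and
isotropic type, but not of group-like type") = the standing hypotheses `Thm42Setting` of [FrdI] Thm. 4.2 for the
operations of `C₁`, `C₂`. Inputs: Thm. 3.7 (i) (`Thm37_i`; L1 `ModelFrobenioid.data_isOfIsotropicType`), Thm. 3.7
(ii) (`Thm37_ii`; `Discharge/Sec3Thm37Standard.lean`). [cite: MochizukiEtTh2009, Cor 3.8 p.81] -/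
def StandardIsotropicNotGroupLike (_h : Cor38Hyp C₁ C₂) : Prop :=
  PreFrobenioidData.Thm42Setting C₁.opsData C₂.opsData

/-- C38-L01 is symmetric in `C₁`, `C₂` (bookkeeping for the `Ψ⁻¹`-directions). [cite: MochizukiEtTh2009, Cor 3.8 p.81] -/
theorem standardIsotropicNotGroupLike_symm (H : h.StandardIsotropicNotGroupLike) :
    PreFrobenioidData.Thm42Setting C₂.opsData C₁.opsData :=
  ⟨⟨H.standard.2, H.standard.1⟩, ⟨H.isotropic.2, H.isotropic.1⟩, ⟨H.notGroupLike.2, H.notGroupLike.1⟩⟩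

/-- **C38-L02a** (p.81 l.2–3: "In particular, by [Mzk17], Theorem 3.4, (ii) … it follows that `Ψ` preserves
pre-steps"): `Ψ` and `Ψ⁻¹` carry pre-steps to pre-steps. [cite: MochizukiEtTh2009, Cor 3.8 p.81] -/
def PreservesPreSteps : Prop :=
  PreFrobenioidData.PreservesMor h.Ψ.functor C₁.opsData.IsPreStep C₂.opsData.IsPreStep ∧
    PreFrobenioidData.PreservesMor h.Ψ.inverse C₂.opsData.IsPreStep C₁.opsData.IsPreStep

/-- **C38-L02b** (p.81 l.2–3: "by … [Mzk17], Theorem 4.2, (i), it follows that `Ψ` preserves … primary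
steps"): `Ψ` and `Ψ⁻¹` carry primary steps to primary steps. [cite: MochizukiEtTh2009, Cor 3.8 p.81] -/
def PreservesPrimarySteps : Prop :=
  PreFrobenioidData.PreservesMor h.Ψ.functor
      (fun _ _ φ => C₁.opsData.IsStep φ ∧ C₁.opsData.IsPrimaryPreStep φ)
      (fun _ _ φ => C₂.opsData.IsStep φ ∧ C₂.opsData.IsPrimaryPreStep φ) ∧
    PreFrobenioidData.PreservesMor h.Ψ.inverse
      (fun _ _ φ => C₂.opsData.IsStep φ ∧ C₂.opsData.IsPrimaryPreStep φ)
      (fun _ _ φ => C₁.opsData.IsStep φ ∧ C₁.opsData.IsPrimaryPreStep φ)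

/-- C38-L02a ⟸ [FrdI] Thm. 3.4 (ii) (for `Ψ`, `Ψ⁻¹`), given quasi-isotropic type (⟸ isotropic, Thm. 3.7 (i), [FrdI]
Rmk. 3.1.1) and `h.fsmff`. PROVED. [cite: MochizukiEtTh2009, Cor 3.8 p.81] -/
theorem preservesPreSteps_of_thm34ii
    (h12 : C₁.opsData.Thm34ii C₂.opsData h.Ψ) (h21 : C₂.opsData.Thm34ii C₁.opsData h.Ψ.symm)
    (hq₁ : C₁.opsData.IsOfQuasiIsotropicType) (hq₂ : C₂.opsData.IsOfQuasiIsotropicType) :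
    h.PreservesPreSteps :=
  ⟨(h12 hq₁ hq₂ h.fsmff.1 h.fsmff.2).1, (h21 hq₂ hq₁ h.fsmff.2 h.fsmff.1).1⟩

/-- C38-L02b ⟸ [FrdI] Thm. 4.2 (i) (for `Ψ`, `Ψ⁻¹`), given C38-L01. PROVED. [cite: MochizukiEtTh2009, Cor 3.8 p.81] -/
theorem preservesPrimarySteps_of_thm42i
    (h12 : C₁.opsData.Thm42i C₂.opsData h.Ψ) (h21 : C₂.opsData.Thm42i C₁.opsData h.Ψ.symm)
    (H : h.StandardIsotropicNotGroupLike) : h.PreservesPrimarySteps :=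
  ⟨(h12 H).1, (h21 (h.standardIsotropicNotGroupLike_symm H)).1⟩

/-- **C38-L03** (p.81 l.3–4: "Moreover, `Ψ` is compatible with the operation of passing to the perfection
[cf. [Mzk17], Theorem 3.4, (iii)]"): a `1`-unique `1`-commutative square `Ψ^pf ∘ (C₁ → C₁^pf) ≅ (C₂ → C₂^pf) ∘ Ψ`
(perfections `P_i`, [FrdI] Prop. 3.2 (i) interface). [cite: MochizukiEtTh2009, Cor 3.8 p.81] -/
def CompatibleWithPerfection (P₁ : PerfectionData C₁.opsData) (P₂ : PerfectionData C₂.opsData) : Prop :=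
  ∃ Ψpf : P₁.Pf ⥤ P₂.Pf, PreFrobenioidData.OneUniqueSquare h.Ψ.functor P₁.toPf P₂.toPf Ψpf

/-- C38-L03 ⟸ [FrdI] Thm. 3.4 (iii) (perfection square), given C38-L01 and hypothesis (b). PROVED. [cite: MochizukiEtTh2009, Cor 3.8 p.81] -/
theorem compatibleWithPerfection_of_thm34iii (P₁ : PerfectionData C₁.opsData)
    (P₂ : PerfectionData C₂.opsData) (h34 : C₁.opsData.Thm34iii_pf C₂.opsData h.Ψ P₁ P₂)
    (H : h.StandardIsotropicNotGroupLike) (hB : PreFrobenioidData.HypB C₁.opsData C₂.opsData h.Ψ) :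
    h.CompatibleWithPerfection P₁ P₂ := by
  obtain ⟨Ψpf, hsq, -⟩ := h34 H.standard.1 H.standard.2 hB
  exact ⟨Ψpf, hsq⟩

/-- **C38-L04** (p.81 l.5–8: "By applying [Mzk17], Theorem 3.4, (iv), in the case of assertion (i), and
[Mzk17], Theorem 3.4, (ii); [Mzk17], Corollary 4.11, (ii), in the case of assertion (ii), it follows that
`Ψ` preserves the submonoids '`O^▷(−)`'"): for `Ψ` and `Ψ⁻¹`, on `endSubmonoid`. [cite: MochizukiEtTh2009, Cor 3.8 p.81] -/
def PreservesOTri : Prop :=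
  (∀ (A : C₁.category) (α : End A), α ∈ C₁.opsData.endSubmonoid A →
      (h.Ψ.functor.map α : End (h.Ψ.functor.obj A)) ∈ C₂.opsData.endSubmonoid (h.Ψ.functor.obj A)) ∧
    ∀ (A : C₂.category) (α : End A), α ∈ C₂.opsData.endSubmonoid A →
      (h.Ψ.inverse.map α : End (h.Ψ.inverse.obj A)) ∈ C₁.opsData.endSubmonoid (h.Ψ.inverse.obj A)

/-- C38-L04, CASE (i) ⟸ [FrdI] Thm. 3.4 (iv) (for `Ψ`, `Ψ⁻¹`; its first conclusion), available when `D₁`, `D₂`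
are Frobenius-slim (hypothesis of Cor. 3.8 (i)). PROVED (specialisation). [cite: MochizukiEtTh2009, Cor 3.8 p.81] -/
theorem preservesOTri_of_thm34iv
    (h12 : C₁.opsData.Thm34iv C₂.opsData h.Ψ) (h21 : C₂.opsData.Thm34iv C₁.opsData h.Ψ.symm)
    (H : h.StandardIsotropicNotGroupLike) (hB : PreFrobenioidData.HypB C₁.opsData C₂.opsData h.Ψ)
    (hB' : PreFrobenioidData.HypB C₂.opsData C₁.opsData h.Ψ.symm)
    (hFs : IsFrobeniusSlim D) (hFs' : IsFrobeniusSlim D') : h.PreservesOTri :=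
  ⟨(h12 H.standard.1 H.standard.2 hB hFs hFs').1, (h21 H.standard.2 H.standard.1 hB' hFs' hFs).1⟩

/-- The conclusion of [FrdI] Cor. 4.11 (ii) for `Ψ` (case (ii) of C38-L04, p.81: "[Mzk17], Corollary 4.11,
(ii)"): a `1`-unique `Ψ^Base : D₁ → D₂` with `Ψ^Base ∘ Base₁ ≅ Base₂ ∘ Ψ`. [cite: MochizukiEtTh2009, Cor 3.8 p.81] -/
def BaseSquare : Prop :=
  ∃ ΨBase : D ⥤ D', PreFrobenioidData.OneUniqueSquare h.Ψ.functor C₁.opsData.base C₂.opsData.base ΨBase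

/-- The same for `Ψ⁻¹` (a `1`-unique `(Ψ⁻¹)^Base : D₂ → D₁`). [cite: MochizukiEtTh2009, Cor 3.8 p.81] -/
def BaseSquareInv : Prop :=
  ∃ ΨBase' : D' ⥤ D, PreFrobenioidData.OneUniqueSquare h.Ψ.inverse C₂.opsData.base C₁.opsData.base ΨBase'

/-- `BaseSquare` ⟸ [FrdI] Cor. 4.11 (ii), given `D₁`, `D₂` Div-slim (hypothesis of Cor. 3.8 (ii), L1's
`PreFrobenioidData.IsDivSlim`). PROVED (specialisation). [cite: MochizukiEtTh2009, Cor 3.8 p.81] -/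
theorem baseSquare_of_cor411ii (h411 : C₁.opsData.Cor411ii C₂.opsData h.Ψ)
    (hds : C₁.opsData.IsDivSlim ∧ C₂.opsData.IsDivSlim) (H : h.StandardIsotropicNotGroupLike)
    (hB : PreFrobenioidData.HypB C₁.opsData C₂.opsData h.Ψ) : h.BaseSquare := by
  obtain ⟨ΨBase, hsq, -⟩ := h411 ⟨hds, H.standard, hB⟩
  exact ⟨ΨBase, hsq⟩

/-- `BaseSquareInv` ⟸ [FrdI] Cor. 4.11 (ii) applied to `Ψ⁻¹`. PROVED. [cite: MochizukiEtTh2009, Cor 3.8 p.81] -/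
theorem baseSquareInv_of_cor411ii (h411 : C₂.opsData.Cor411ii C₁.opsData h.Ψ.symm)
    (hds : C₁.opsData.IsDivSlim ∧ C₂.opsData.IsDivSlim) (H : h.StandardIsotropicNotGroupLike)
    (hB' : PreFrobenioidData.HypB C₂.opsData C₁.opsData h.Ψ.symm) : h.BaseSquareInv := by
  obtain ⟨ΨBase', hsq, -⟩ := h411 ⟨⟨hds.2, hds.1⟩, (h.standardIsotropicNotGroupLike_symm H).standard, hB'⟩
  exact ⟨ΨBase', hsq⟩

/-- "`Ψ` preserves linear morphisms" ([FrdI] Thm. 3.4 (iii); the degree half of "preserves `O^▷(−)`", p.81),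
for `Ψ` and `Ψ⁻¹`. [cite: MochizukiEtTh2009, Cor 3.8 p.81] -/
def PreservesLinear : Prop :=
  PreFrobenioidData.PreservesMor h.Ψ.functor C₁.opsData.IsLinear C₂.opsData.IsLinear ∧
    PreFrobenioidData.PreservesMor h.Ψ.inverse C₂.opsData.IsLinear C₁.opsData.IsLinear

/-- `PreservesLinear` ⟸ [FrdI] Thm. 3.4 (iii) (for `Ψ`, `Ψ⁻¹`). PROVED. [cite: MochizukiEtTh2009, Cor 3.8 p.81] -/
theorem preservesLinear_of_thm34iii
    (h12 : C₁.opsData.Thm34iii C₂.opsData h.Ψ) (h21 : C₂.opsData.Thm34iii C₁.opsData h.Ψ.symm)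
    (H : h.StandardIsotropicNotGroupLike) (hB : PreFrobenioidData.HypB C₁.opsData C₂.opsData h.Ψ)
    (hB' : PreFrobenioidData.HypB C₂.opsData C₁.opsData h.Ψ.symm) : h.PreservesLinear :=
  ⟨(h12 H.standard.1 H.standard.2 hB).1.2.1, (h21 H.standard.2 H.standard.1 hB').1.2.1⟩

/-- A `1`-commutative base square makes `Ψ` carry base-identity endomorphisms to base-identity ones:
`Base₂(Ψ α) ∘ e_A = e_A ∘ Ψ^Base(Base₁ α) = e_A` (the step of C38-L04, case (ii), left to the reader). PROVED.
[cite: MochizukiEtTh2009, Cor 3.8 p.81] -/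
theorem isBaseIdentity_map_of_oneCommutes {E₁ : Type*} [Category E₁] {E₂ : Type*} [Category E₂]
    {B₁ : Type*} [Category B₁] {B₂ : Type*} [Category B₂] (S₁ : PreFrobenioidData E₁ B₁)
    (S₂ : PreFrobenioidData E₂ B₂) (Φf : E₁ ⥤ E₂) (ΦB : B₁ ⥤ B₂)
    (hc : OneCommutes Φf S₂.base S₁.base ΦB) {A : E₁} {α : A ⟶ A} (hα : S₁.IsBaseIdentity α) :
    S₂.IsBaseIdentity (Φf.map α) := by
  obtain ⟨e⟩ := hc
  have hnat := e.hom.naturality α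
  have h1 : (S₁.base ⋙ ΦB).map α = 𝟙 _ := by
    rw [Functor.comp_map, show S₁.base.map α = 𝟙 _ from hα, ΦB.map_id]; rfl
  rw [h1] at hnat
  erw [Category.comp_id] at hnat
  show (Φf ⋙ S₂.base).map α = 𝟙 _
  rw [← cancel_mono (e.hom.app A), hnat, Category.id_comp]

/-- C38-L04, CASE (ii) ⟸ the base squares of [FrdI] Cor. 4.11 (ii) for `Ψ`, `Ψ⁻¹` + preservation of linear
morphisms (Thm. 3.4 (iii)): `O^▷(A)` = base-identity linear endomorphisms. PROVED. [cite: MochizukiEtTh2009, Cor 3.8 p.81] -/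
theorem preservesOTri_of_baseSquare (hsq : h.BaseSquare) (hsq' : h.BaseSquareInv)
    (hlin : h.PreservesLinear) : h.PreservesOTri := by
  obtain ⟨ΨBase, ⟨-, hc, -⟩⟩ := hsq
  obtain ⟨ΨBase', ⟨-, hc', -⟩⟩ := hsq'
  refine ⟨fun A α hα => ⟨?_, hlin.1 α hα.2⟩, fun A α hα => ⟨?_, hlin.2 α hα.2⟩⟩
  · exact isBaseIdentity_map_of_oneCommutes C₁.opsData C₂.opsData h.Ψ.functor ΨBase hc hα.1
  · exact isBaseIdentity_map_of_oneCommutes C₂.opsData C₁.opsData h.Ψ.inverse ΨBase' hc' hα.1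

/-- **C38-L06** (p.81 l.14–15: "Thus, `Ψ` preserves the base-field-theoretic pre-steps"): for a pre-step
`φ` of `C₁`, `φ` is base-field-theoretic iff `Ψ φ` is, and likewise for `Ψ⁻¹`.
[cite: MochizukiEtTh2009, Cor 3.8 p.81] -/
def PreservesBsFldPreSteps : Prop :=
  (∀ ⦃A B : C₁.category⦄ (φ : A ⟶ B), C₁.opsData.IsPreStep φ →
      (C₁.IsBaseFieldTheoretic φ ↔ C₂.IsBaseFieldTheoretic (h.Ψ.functor.map φ))) ∧
    ∀ ⦃A B : C₂.category⦄ (φ : A ⟶ B), C₂.opsData.IsPreStep φ →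
      (C₂.IsBaseFieldTheoretic φ ↔ C₁.IsBaseFieldTheoretic (h.Ψ.inverse.map φ))

/-- **C38-L06 ⟸ C38-L02a, L03, L04, L05** (p.81, "Thus"): the TRANSPORT row. Print transports the criterion
C38-L05 along the `Ψ^pf` of C38-L03; what that uses is that `Ψ^pf` preserves (co-angular) pre-steps and `O^▷(−)`
OF THE PERFECTIONS ([FrdI] Thm. 3.4 (ii)/(iv) applied to `Ψ^pf`; `C_i^pf` are again tempered Frobenioids, Rmk.
3.6.4) — taken here as explicit hypotheses on `Ψ^pf` (v2: v1 listed only the `C`-level L02a/L04, which do not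
determine `P_i.ops`). Named `Prop` implication (to be proved). [cite: MochizukiEtTh2009, Cor 3.8 p.81] -/
def PreservesBsFldPreStepsOfCriterion (P₁ : PerfectionData C₁.opsData) (P₂ : PerfectionData C₂.opsData) : Prop :=
  h.PreservesPreSteps → C₁.BsFldPreStepLimitCriterion P₁ → C₂.BsFldPreStepLimitCriterion P₂ →
    ∀ Ψpf : P₁.Pf ≌ P₂.Pf, OneCommutes h.Ψ.functor P₂.toPf P₁.toPf Ψpf.functor →
      PreFrobenioidData.PreservesMor Ψpf.functor P₁.ops.IsCoAngularPreStep P₂.ops.IsCoAngularPreStep →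
      PreFrobenioidData.PreservesMor Ψpf.inverse P₂.ops.IsCoAngularPreStep P₁.ops.IsCoAngularPreStep →
      (∀ (X : P₁.Pf) (ε : End X), ε ∈ P₁.ops.endSubmonoid X →
          (Ψpf.functor.map ε : End (Ψpf.functor.obj X)) ∈ P₂.ops.endSubmonoid (Ψpf.functor.obj X)) →
      (∀ (X : P₂.Pf) (ε : End X), ε ∈ P₂.ops.endSubmonoid X →
          (Ψpf.inverse.map ε : End (Ψpf.inverse.obj X)) ∈ P₁.ops.endSubmonoid (Ψpf.inverse.obj X)) →
        h.PreservesBsFldPreSteps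

/-- **C38-L07** (p.81 l.15–18: "Note, moreover, that `Ψ` preserves [cf. [Mzk17], Theorem 3.4, (ii), (iii)]
the factorization [cf. [Mzk17], Definition 1.3, (iv), (a)] of a morphism of `C_i` into a composite of a
morphism of Frobenius type, a pre-step, and a pull-back morphism"): `Ψ` and `Ψ⁻¹` carry morphisms of
Frobenius type, pre-steps and pull-back morphisms to such. [cite: MochizukiEtTh2009, Cor 3.8 p.81] -/
def PreservesFactorisation : Prop :=
  h.PreservesPreSteps ∧
    (PreFrobenioidData.PreservesMor h.Ψ.functor C₁.opsData.IsFrobeniusType C₂.opsData.IsFrobeniusType ∧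
      PreFrobenioidData.PreservesMor h.Ψ.inverse C₂.opsData.IsFrobeniusType C₁.opsData.IsFrobeniusType) ∧
    PreFrobenioidData.PreservesMor h.Ψ.functor C₁.opsData.IsPullbackMorphism C₂.opsData.IsPullbackMorphism ∧
      PreFrobenioidData.PreservesMor h.Ψ.inverse C₂.opsData.IsPullbackMorphism C₁.opsData.IsPullbackMorphism

/-- C38-L07 ⟸ [FrdI] Thm. 3.4 (ii) (pre-steps) and (iii) (Frobenius type, pull-backs), for `Ψ` and `Ψ⁻¹`.
PROVED (specialisation). [cite: MochizukiEtTh2009, Cor 3.8 p.81] -/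
theorem preservesFactorisation_of_thm34 (hps : h.PreservesPreSteps)
    (h12 : C₁.opsData.Thm34iii C₂.opsData h.Ψ) (h21 : C₂.opsData.Thm34iii C₁.opsData h.Ψ.symm)
    (H : h.StandardIsotropicNotGroupLike) (hB : PreFrobenioidData.HypB C₁.opsData C₂.opsData h.Ψ)
    (hB' : PreFrobenioidData.HypB C₂.opsData C₁.opsData h.Ψ.symm) : h.PreservesFactorisation := by
  have a := (h12 H.standard.1 H.standard.2 hB).1
  have b := (h21 H.standard.2 H.standard.1 hB').1
  exact ⟨hps, ⟨a.1, b.1⟩, a.2.2.2.2.1, b.2.2.2.2.1⟩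

/-- **C38-L07b** (implicit in p.81 l.15–19): for `f = F ≫ φ ≫ λ` with `F` of Frobenius type, `φ` a pre-step and
`λ` a pull-back morphism, `f` is base-field-theoretic iff `φ` is (`Div(F) = Div(λ) = 0`, `deg_Fr(λ) = 1`;
`Φ^{bs-fld}` is a subfunctor). Named `Prop` (one Frobenioid). [cite: MochizukiEtTh2009, Cor 3.8 p.81] -/
def _root_.Literature.AnabelianGeometry.EtaleTheta.TemperedFrobenioid.BsFldOfFactorisation
    (C : TemperedFrobenioid T D VD) : Prop :=
  ∀ ⦃A A' B' B : C.category⦄ (F : A ⟶ A') (φ : A' ⟶ B') (l : B' ⟶ B),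
    C.opsData.IsFrobeniusType F → C.opsData.IsPreStep φ → C.opsData.IsPullbackMorphism l →
      (C.IsBaseFieldTheoretic (F ≫ φ ≫ l) ↔ C.IsBaseFieldTheoretic φ)

/-- **C38-L07c**: the existence half of [FrdI] Def. 1.3 (iv)(a) used on p.81 — every morphism of `C` factors as
(Frobenius type) ≫ (pre-step) ≫ (pull-back). Named `Prop`. [cite: MochizukiEtTh2009, Cor 3.8 p.81] -/
def _root_.Literature.AnabelianGeometry.EtaleTheta.TemperedFrobenioid.HasFactorisations
    (C : TemperedFrobenioid T D VD) : Prop :=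
  ∀ ⦃A B : C.category⦄ (f : A ⟶ B), ∃ (A' B' : C.category) (F : A ⟶ A') (φ : A' ⟶ B') (l : B' ⟶ B),
    C.opsData.IsFrobeniusType F ∧ C.opsData.IsPreStep φ ∧ C.opsData.IsPullbackMorphism l ∧ F ≫ φ ≫ l = f

/-- `HasFactorisations` holds as soon as `C → F_Φ` is a Frobenioid ([FrdI] Def. 1.3 (iv)(a); here [FrdI] Thm.
5.2 (ii), L1). PROVED: L1's `IsFrobenioid.iv_a_exists` through the `ofFunctor` dictionary.
[cite: MochizukiFrdI2008, Def. 1.3 (iv) p.24] -/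
theorem _root_.Literature.AnabelianGeometry.EtaleTheta.TemperedFrobenioid.hasFactorisations_of_isFrobenioid
    (C : TemperedFrobenioid T D VD) (hF : PreFrobenioid.IsFrobenioid C.toElem) : C.HasFactorisations := by
  intro A B f
  obtain ⟨X, Y, γ, β, α, hf, hγ, hβ, hα⟩ := hF.iv_a_exists f
  exact ⟨X, Y, γ, β, α, (PreFrobenioidData.ofFunctor_isFrobeniusType C.toElem γ).2 hγ,
    (PreFrobenioidData.ofFunctor_isPreStep C.toElem β).2 hβ,
    (PreFrobenioidData.ofFunctor_isPullbackMorphism C.toElem α).2 hα, hf⟩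

/-- **C38-L08 = Cor. 3.8 (i)'s conclusion ⟸ C38-L06, L07, L07b, L07c** (p.81 l.18–19: "Thus, we conclude that
`Ψ` preserves the base-field-theoretic morphisms"). PROVED (pure logic). [cite: MochizukiEtTh2009, Cor 3.8 p.81] -/
theorem preservesBaseFieldTheoretic_of_rows (h6 : h.PreservesBsFldPreSteps) (h7 : h.PreservesFactorisation)
    (hf₁ : C₁.HasFactorisations) (hb₁ : C₁.BsFldOfFactorisation) (hb₂ : C₂.BsFldOfFactorisation) :
    PreservesBaseFieldTheoretic h := by
  intro A B f
  obtain ⟨A', B', F, φ, l, hF, hφ, hl, rfl⟩ := hf₁ f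
  rw [hb₁ F φ l hF hφ hl, h.Ψ.functor.map_comp, h.Ψ.functor.map_comp,
    hb₂ _ _ _ (h7.2.1.1 F hF) (h7.1.1 φ hφ) (h7.2.2.1 l hl)]
  exact h6.1 φ hφ

/-- **C38-L09** (p.81 l.20 – p.82 l.1: "under the assumptions of assertion (ii), `Ψ` preserves [cf. [Mzk17],
Theorem 3.4, (iii); [Mzk17], Corollary 4.11, (ii)] the Frobenius-trivial objects"), for `Ψ` and `Ψ⁻¹`
([FrdI] Def. 1.2 (iv) `IsFrobeniusTrivial`). [cite: MochizukiEtTh2009, Cor 3.8 p.82] -/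
def PreservesFrobeniusTrivial : Prop :=
  PreFrobenioidData.PreservesObj h.Ψ.functor C₁.opsData.IsFrobeniusTrivial C₂.opsData.IsFrobeniusTrivial ∧
    PreFrobenioidData.PreservesObj h.Ψ.inverse C₂.opsData.IsFrobeniusTrivial C₁.opsData.IsFrobeniusTrivial

/-- **C38-L09 ⟸ [FrdI] Thm. 3.4 (iii) + the base squares of Cor. 4.11 (ii)** (p.82 l.1): transport the section
`ζ : ℕ_{≥1} → End(A)`; `Ψ` preserves Frobenius type and degrees (Thm. 3.4 (iii); `C_i` admit non-group-like
objects) and base-identity endomorphisms (base square). Named `Prop` implication. [cite: MochizukiEtTh2009, Cor 3.8 p.82] -/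
def PreservesFrobeniusTrivialOfInputs : Prop :=
  h.BaseSquare → h.BaseSquareInv → C₁.opsData.Thm34iii C₂.opsData h.Ψ →
    C₂.opsData.Thm34iii C₁.opsData h.Ψ.symm → h.StandardIsotropicNotGroupLike →
      PreFrobenioidData.HypB C₁.opsData C₂.opsData h.Ψ → PreFrobenioidData.HypB C₂.opsData C₁.opsData h.Ψ.symm →
        h.PreservesFrobeniusTrivial

/-- **C38-L10 = Cor. 3.8 (ii)'s second conclusion** (p.82 l.1–5: "… it follows from the explicit description of
the base-field-theoretic hull given in Remark 3.6.3 that `Ψ` preserves the [objects and morphisms of the]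
subcategories `C₁^bs-fld ⊆ C₁`, `C₂^bs-fld ⊆ C₂`, hence induces an equivalence of categories `C₁^bs-fld ⥲ C₂^bs-fld`")
= the second conjunct of `Cor38_ii` (REAL hull categories). [cite: MochizukiEtTh2009, Cor 3.8 p.82] -/
def InducesHullEquivalence : Prop :=
  ∃ Ψbs : C₁.hullCategory ≌ C₂.hullCategory, Nonempty (C₁.hull ⋙ h.Ψ.functor ≅ Ψbs.functor ⋙ C₂.hull)

/-- "the objects of `C` that may be 'linked' to a Frobenius-trivial object via base-field theoretic
pre-steps" (Rmk. 3.6.3, PDF p.78 l.−1 – p.79 l.1): `A₀`, `A` joined by a zigzag of base-field-theoretic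
pre-steps. [cite: MochizukiEtTh2009, Rmk 3.6.3 p.79] -/
def _root_.Literature.AnabelianGeometry.EtaleTheta.TemperedFrobenioid.LinkedByBsFldPreSteps
    (C : TemperedFrobenioid T D VD) : C.category → C.category → Prop :=
  Relation.EqvGen fun X Y => ∃ φ : X ⟶ Y, C.opsData.IsPreStep φ ∧ C.IsBaseFieldTheoretic φ

/-- **Rmk. 3.6.3, OBJECT clause** (PDF pp.78–79: "the objects of the essential image of the natural functor
`C^bs-fld → C` may be described as the objects of `C` that may be 'linked' to a Frobenius-trivial object via
base-field theoretic pre-steps") — the clause of Rmk. 3.6.3 NOT carried by L2-t3's `Remark363` (merge-pass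
item), used on p.82 l.2–3. Named `Prop` (one Frobenioid). [cite: MochizukiEtTh2009, Rmk 3.6.3 p.79] -/
def _root_.Literature.AnabelianGeometry.EtaleTheta.TemperedFrobenioid.HullEssImageObjClause
    (C : TemperedFrobenioid T D VD) : Prop :=
  ∀ A : C.category, essImageObj C.hull A ↔ ∃ A₀, C.opsData.IsFrobeniusTrivial A₀ ∧ C.LinkedByBsFldPreSteps A₀ A

/-- **C38-L10 ⟸ Rmk. 3.6.3 (both clauses, both sides) + hull faithful (Def. 3.6 (iv) "natural faithful functor",
`HullFaithful`, L2-t3 `Sec3HullFaithful`) + C38-L02a, L06, L08, L09** (p.82 l.1–5): an equivalence preserving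
Frobenius-trivial objects, pre-steps, base-field-theoretic pre-steps and morphisms restricts to the hulls (v2: +
L02a, used to carry the zigzags of the object clause). Named `Prop` implication (to be proved).
[cite: MochizukiEtTh2009, Cor 3.8 p.82] -/
def InducesHullEquivalenceOfRows : Prop :=
  C₁.Remark363 → C₂.Remark363 → C₁.HullEssImageObjClause → C₂.HullEssImageObjClause →
    C₁.HullFaithful → C₂.HullFaithful → h.PreservesPreSteps → h.PreservesFrobeniusTrivial →
      h.PreservesBsFldPreSteps → PreservesBaseFieldTheoretic h → h.InducesHullEquivalence

/-! ### Assembly: the rows close abc-iut-L2-t3's typed statements -/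

/-- **Cor. 3.8 (i) from the rows**: with L1's `IsFrobeniusSlim` instantiating the vocabulary parameter of
`Cor38_i`, the typed statement follows from C38-L06, L07, L07b, L07c. PROVED. [cite: MochizukiEtTh2009, Cor 3.8 p.81] -/
theorem cor38_i_of_rows
    (h6 : IsFrobeniusSlim D → IsFrobeniusSlim D' → h.PreservesBsFldPreSteps) (h7 : h.PreservesFactorisation)
    (hf₁ : C₁.HasFactorisations) (hb₁ : C₁.BsFldOfFactorisation) (hb₂ : C₂.BsFldOfFactorisation) :
    Cor38_i (fun E _ => IsFrobeniusSlim E) h :=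
  fun hs hs' => h.preservesBaseFieldTheoretic_of_rows (h6 hs hs') h7 hf₁ hb₁ hb₂

/-- **Cor. 3.8 (ii) from the rows**: for any vocabulary parameter `IsDivSlim` implying L1's
`PreFrobenioidData.IsDivSlim` of the operations (which feeds C38-L04 case (ii), hence L06), `Cor38_ii` follows
from C38-L06, L07, L07b, L07c and L10. PROVED (pure logic). [cite: MochizukiEtTh2009, Cor 3.8 p.82] -/
theorem cor38_ii_of_rows (IsDivSlim : ∀ (E : Type u) [Category.{v} E], (Eᵒᵖ ⥤ CommMonCat.{w}) → Prop)
    (hvoc₁ : IsDivSlim D C₁.divisorMonoid → C₁.opsData.IsDivSlim)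
    (hvoc₂ : IsDivSlim D' C₂.divisorMonoid → C₂.opsData.IsDivSlim)
    (h6 : C₁.opsData.IsDivSlim → C₂.opsData.IsDivSlim → h.PreservesBsFldPreSteps)
    (h7 : h.PreservesFactorisation) (hf₁ : C₁.HasFactorisations)
    (hb₁ : C₁.BsFldOfFactorisation) (hb₂ : C₂.BsFldOfFactorisation)
    (h10 : h.PreservesBsFldPreSteps → PreservesBaseFieldTheoretic h → h.InducesHullEquivalence) :
    Cor38_ii IsDivSlim h := by
  intro hd hd'
  have h6' := h6 (hvoc₁ hd) (hvoc₂ hd')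
  have h8 : PreservesBaseFieldTheoretic h := h.preservesBaseFieldTheoretic_of_rows h6' h7 hf₁ hb₁ hb₂
  exact ⟨h8, h10 h6' h8⟩

end Cor38Hyp

end Rows

end Literature.AnabelianGeometry.EtaleTheta
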